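import Mathlib.Algebra.CharP.Two
import Mathlib.Combinatorics.SimpleGraph.Finite
import Mathlib.Combinatorics.SimpleGraph.Maps
import Mathlib.Data.ZMod.Basic
import HarnessLib

/-!
# The degree-parity system of a finite graph: an isomorphism-invariant polynomial-time property of
# unbounded counting width

Topic `Literature/ModelTheory/FiniteModelTheory`. With every finite simple graph `G` we associate a
system of linear equations over `𝔽₂` READ OFF THE DEGREES — one unknown `U_v` per vertex and
* for every vertex `z` of degree `2`: `∑_{y ∼ z} U_y = 1`,
* for every vertex `z` of degree `3`: `∑_{y ∼ z} U_y = 0`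
(`IsParitySolution`, `ParitySolvable`). Solvability of systems of linear equations over `𝔽₂` is the
paradigmatic polynomial-time property that is not definable in fixed-point logic with counting and
has linear counting width (Atserias–Bulatov–Dawar 2009, via the Cai–Fürer–Immerman construction;
Atserias–Dawar 2019, Theorem 3.8); the point of THIS rendering is that the system is defined from the
abstract graph by a local, degree-based rule, so that `ParitySolvable` is manifestly invariant under
isomorphisms (`paritySolvable_iff_of_iso`) and under adding isolated vertices
(`paritySolvable_iff_of_embedding`), while still decoding 3XOR systems
(`XorGraphParityDecoding.lean`: for the encoding graphs of `XorGraphEncoding.lean`,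
`ParitySolvable (xgraph vr b) ↔ (b is satisfiable)`), so that it has unbounded counting width, and
it is decidable in polynomial time (Gaussian elimination; `DegreeParitySystemFP.lean`). This file:
the system, its solvability, and the transfer of solvability along embeddings with isolated
complement.

## References

* A. Atserias, A. Bulatov, A. Dawar, *Affine systems of equations and counting infinitary logic*,
  Theoret. Comput. Sci. 410 (2009) 1666–1683, §4–5 (solvability over `𝔽₂` is not in `C^ω_∞ω`)
  [AtseriasBulatovDawar2009].
* A. Atserias, A. Dawar, *Definable inapproximability: new challenges for duplicator*, J. Logic
  Comput. 29 (2019), §3.2, Lemma 3.2, Theorem 3.8 [AtseriasDawar2019].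

## Design notes

The degree-based decoding is this file's device (not in the sources); all statements about it are
proved here. Decidability of adjacency is a parameter (`[DecidableRel G.Adj]`); the solvability
predicate does not depend on the instance (`paritySolvable_congr_dec`). `IsParitySolution` and
`ParitySolvable` are PREDICATES on finite graphs — the graph `G` (with its decidable adjacency) is an
explicit argument written on the `def` line itself, not a section variable — and not closed
propositions: there is no `ParitySolvable_holds` to prove (`paritySolvable_bot` is a solvable instance,
`not_paritySolvable_top_fin_three` an unsolvable one); solvability is DECIDED, in polynomial time, in
`DegreeParitySystemFP.lean`.
-/

namespace Literature.ModelTheory.FiniteModelTheory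

open Finset

/-! ### The system and its solvability -/

section System

variable {V : Type*} [Fintype V]

/-- **A solution of the degree-parity system of `G`**: an assignment `U : V → 𝔽₂` with
`∑_{y ∼ z} U_y = 1` at every vertex `z` of degree `2` and `∑_{y ∼ z} U_y = 0` at every vertex of
degree `3` (a system of linear equations over `𝔽₂` read off the graph; this degree-based
presentation is the file's rendering of the structures of Atserias–Bulatov–Dawar 2009, §4).
A predicate on the pair (`G`, `U`).
[cite: AtseriasBulatovDawar2009, §4 (systems of linear equations over 𝔽₂ as structures)] -/
def IsParitySolution (G : SimpleGraph V) [DecidableRel G.Adj] (U : V → ZMod 2) : Prop :=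
  ∀ z, (G.degree z = 2 → ∑ y ∈ G.neighborFinset z, U y = 1) ∧
    (G.degree z = 3 → ∑ y ∈ G.neighborFinset z, U y = 0)

/-- **The degree-parity system of `G` is solvable** (some `U : V → 𝔽₂` satisfies every degree-`2` and
degree-`3` equation; the degree-based choice of equations is this file's, the object — solvability of a
system of linear equations over `𝔽₂` presented by a finite structure — is that of Atserias–Bulatov–Dawar
2009, §4). A predicate on finite graphs `G` (true of `⊥`, `paritySolvable_bot`; false of the triangle,
`not_paritySolvable_top_fin_three`), not a proposition asserted of every graph.
[cite: AtseriasBulatovDawar2009, §4] -/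
def ParitySolvable (G : SimpleGraph V) [DecidableRel G.Adj] : Prop :=
  ∃ U : V → ZMod 2, IsParitySolution G U

variable (G : SimpleGraph V)

/-- Non-vacuity: a graph without vertices of degree `2` or `3` (e.g. the edgeless graph) has a solvable
degree-parity system — there are no equations. [folklore] -/
theorem paritySolvable_of_forall_degree [DecidableRel G.Adj] (h : ∀ z, G.degree z ≠ 2 ∧ G.degree z ≠ 3) :
    ParitySolvable G :=
  ⟨fun _ => 0, fun z => ⟨fun h2 => absurd h2 (h z).1, fun h3 => absurd h3 (h z).2⟩⟩

/-- The edgeless graph has a solvable degree-parity system. [folklore] -/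
theorem paritySolvable_bot [DecidableRel (⊥ : SimpleGraph V).Adj] : ParitySolvable (⊥ : SimpleGraph V) :=
  paritySolvable_of_forall_degree _ fun z => by simp

/-- Solvability does not depend on the decidability instance of the adjacency. [folklore] -/
theorem paritySolvable_congr_dec (I₁ I₂ : DecidableRel G.Adj) :
    @ParitySolvable V _ G I₁ ↔ @ParitySolvable V _ G I₂ := by
  rw [Subsingleton.elim I₁ I₂]

end System

/-! ### Invariance under embeddings with isolated complement (isomorphisms, padding) -/

section Transfer

variable {V W : Type*} [Fintype V] [Fintype W]
  {G : SimpleGraph V} {H : SimpleGraph W} [DecidableRel G.Adj] [DecidableRel H.Adj]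

/-- Along an injective map reflecting adjacency, neighbourhoods are mapped neighbourhoods — provided
no vertex outside the range is adjacent to the range. [folklore] -/
theorem neighborFinset_eq_map {f : W → V} (hf : Function.Injective f)
    (hadj : ∀ a b, G.Adj (f a) (f b) ↔ H.Adj a b) (hiso : ∀ v, (∀ a, f a ≠ v) → ∀ w, ¬ G.Adj v w)
    (a : W) : G.neighborFinset (f a) = (H.neighborFinset a).map ⟨f, hf⟩ := by
  ext v
  simp only [SimpleGraph.mem_neighborFinset, Finset.mem_map, Function.Embedding.coeFn_mk]
  constructor
  · intro h
    by_cases hv : ∃ b, f b = v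
    · obtain ⟨b, rfl⟩ := hv
      exact ⟨b, (hadj a b).1 h, rfl⟩
    · push Not at hv
      exact absurd (G.adj_symm h) (hiso v hv (f a))
  · rintro ⟨b, hb, rfl⟩
    exact (hadj a b).2 hb

/-- **Transfer of solvability along an embedding whose complement is isolated**: if `f : W → V` is
injective, reflects adjacency, and every vertex of `G` outside its range is isolated, then the
degree-parity systems of `G` and `H` are equisolvable (isolated vertices carry no equation and occur
in none). Covers isomorphisms and padding by isolated vertices. [folklore] -/
theorem paritySolvable_iff_of_embedding {f : W → V} (hf : Function.Injective f)
    (hadj : ∀ a b, G.Adj (f a) (f b) ↔ H.Adj a b) (hiso : ∀ v, (∀ a, f a ≠ v) → ∀ w, ¬ G.Adj v w) :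
    ParitySolvable G ↔ ParitySolvable H := by
  have hN := neighborFinset_eq_map hf hadj hiso
  have hdeg : ∀ a, G.degree (f a) = H.degree a := fun a => by
    rw [← SimpleGraph.card_neighborFinset_eq_degree, ← SimpleGraph.card_neighborFinset_eq_degree, hN,
      Finset.card_map]
  have hdeg0 : ∀ v, (∀ a, f a ≠ v) → G.degree v = 0 := fun v hv => by
    rw [← SimpleGraph.card_neighborFinset_eq_degree, Finset.card_eq_zero, Finset.eq_empty_iff_forall_notMem]
    intro w hw
    exact hiso v hv w ((SimpleGraph.mem_neighborFinset _ _ _).1 hw)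
  constructor
  · rintro ⟨U, hU⟩
    refine ⟨U ∘ f, fun a => ?_⟩
    have h1 : ∑ y ∈ H.neighborFinset a, (U ∘ f) y = ∑ y ∈ G.neighborFinset (f a), U y := by
      rw [hN, Finset.sum_map]; rfl
    rw [h1, ← hdeg a]
    exact hU (f a)
  · rintro ⟨U', hU'⟩
    classical
    refine ⟨fun v => if h : ∃ a, f a = v then U' h.choose else 0, fun v => ?_⟩
    by_cases hv : ∃ a, f a = v
    · obtain ⟨a, rfl⟩ := hv
      have h1 : ∑ y ∈ G.neighborFinset (f a), (if h : ∃ a, f a = y then U' h.choose else 0) =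
          ∑ y ∈ H.neighborFinset a, U' y := by
        rw [hN, Finset.sum_map]
        refine Finset.sum_congr rfl fun b _ => ?_
        have hb : ∃ a', f a' = (⟨f, hf⟩ : W ↪ V) b := ⟨b, rfl⟩
        rw [dif_pos hb]
        exact congrArg U' (hf hb.choose_spec)
      rw [h1, hdeg a]
      exact hU' a
    · push Not at hv
      rw [hdeg0 v hv]
      exact ⟨fun h => absurd h (by decide), fun h => absurd h (by decide)⟩

/-- **Isomorphism invariance** of solvability of the degree-parity system. [folklore] -/
theorem paritySolvable_iff_of_iso (e : G ≃g H) : ParitySolvable G ↔ ParitySolvable H :=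
  paritySolvable_iff_of_embedding (f := e.symm) e.symm.injective (fun _ _ => e.symm.map_adj_iff)
    fun v hv => absurd (e.symm.apply_symm_apply v) (hv (e v))

end Transfer

/-! ### An unsolvable instance: `ParitySolvable` is a genuine graph property

`ParitySolvable G` is a PREDICATE on finite graphs (it is decided, in polynomial time, in
`DegreeParitySystemFP.lean`), not a statement asserted of every graph: the edgeless graph is solvable
(`paritySolvable_bot`) while the triangle is not (`not_paritySolvable_top_fin_three`). -/

section Unsolvable

/-- In the triangle `K₃ = ⊤ : SimpleGraph (Fin 3)` the neighbours of a vertex are the two other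
vertices. [folklore] -/
theorem neighborFinset_top_fin_three (z : Fin 3) :
    (⊤ : SimpleGraph (Fin 3)).neighborFinset z = Finset.univ.erase z := by
  ext y
  simp [SimpleGraph.mem_neighborFinset, Finset.mem_erase, eq_comm]

/-- **The triangle has an unsolvable degree-parity system.** In `K₃` every vertex has degree `2`, so
the system reads `U₁ + U₂ = 1`, `U₀ + U₂ = 1`, `U₀ + U₁ = 1`; summing the three equations gives
`0 = 1` in `𝔽₂`. [folklore] -/
theorem not_paritySolvable_top_fin_three : ¬ ParitySolvable (⊤ : SimpleGraph (Fin 3)) := by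
  rintro ⟨U, hU⟩
  have hdeg : ∀ z : Fin 3, (⊤ : SimpleGraph (Fin 3)).degree z = 2 := fun z => by
    rw [← SimpleGraph.card_neighborFinset_eq_degree, neighborFinset_top_fin_three,
      Finset.card_erase_of_mem (Finset.mem_univ _)]
    rfl
  have h := fun z => (hU z).1 (hdeg z)
  simp only [neighborFinset_top_fin_three] at h
  have e0 : (Finset.univ : Finset (Fin 3)).erase 0 = {1, 2} := by decide
  have e1 : (Finset.univ : Finset (Fin 3)).erase 1 = {0, 2} := by decide
  have e2 : (Finset.univ : Finset (Fin 3)).erase 2 = {0, 1} := by decide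
  have h0 := h 0
  have h1 := h 1
  have h2 := h 2
  rw [e0, Finset.sum_pair (by decide)] at h0
  rw [e1, Finset.sum_pair (by decide)] at h1
  rw [e2, Finset.sum_pair (by decide)] at h2
  have key : ∀ a b c : ZMod 2, b + c = 1 → a + c = 1 → a + b = 1 → False := by decide
  exact key _ _ _ h0 h1 h2

/-- **`ParitySolvable` does not hold of every finite graph** (witness: the triangle), so — together
with `paritySolvable_bot` — it is a non-trivial, isomorphism-invariant property of finite graphs to
be decided, not a theorem about all graphs. [folklore] -/
theorem not_forall_paritySolvable :
    ¬ ∀ (V : Type) [Fintype V] (G : SimpleGraph V) [DecidableRel G.Adj], ParitySolvable G :=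
  fun h => not_paritySolvable_top_fin_three (h (Fin 3) ⊤)

end Unsolvable

end Literature.ModelTheory.FiniteModelTheory
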